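import Summits.Ventures.HodgeRepro2.T5InertLatticeNormalForm
import Summits.Ventures.HodgeRepro2.T5InertPlaceCompletionIsotropy
import Summits.Ventures.HodgeRepro2.T5SelfDualLatticeDet
import Summits.Ventures.HodgeRepro2.T5InertHeckeCommutative

/-!
# The normal form of a unimodular hermitian lattice of rank 3 at an inert place: `antidiag(1, 1, 1)`
(cell pub-hodge-repro2, seat p3)

Tier-5 N3 support (LEAN-ANNEX-p8.md §108 / T5-147: «what stays prose: … the record's choice of a self-dual
`L_v`»). Seat p8's T5-141 `exists_congruent_J3_integral_of_isotropic_of_unramified'` puts every unimodular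
hermitian `3 × 3` Gram matrix over a quadratic unramified extension into the form `Pᴴ H P = antidiag(1, u₀, 1)`,
`P` integral with unit determinant, `u₀ ∈ R₀ˣ`, PROVIDED an isotropic vector is given; p8's T5-155 supplies the
isotropic vector on Mathlib's completions at an inert place (`exists_isotropic_adicCompletion`) and the norm
theorem for units (`exists_isInteger_conj_mul_eq_unit_adicCompletion`: every `u₀ ∈ O_Kvˣ` is `σ z · z`). Here the
three are composed on the record's local fields `K_v ⊆ L_w` (`[L_w : K_v] = 2`, a uniformiser `ϖ` of `O_Kv` that
stays irreducible in `O_Lw`, the conjugation `σ ≠ 1`, the star `starRingOfQuadratic h2 σ hσ`):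
* `exists_congruent_J3_integral_adicCompletion` — T5-141′ with NO isotropy hypothesis;
* **`exists_congruent_J3_one_adicCompletion`** — `u₀ = 1`: scaling the middle basis vector by `z⁻¹`
  (T5-147's `conjTranspose_diagonal_mul_J3_mul_diagonal`, `star z⁻¹ · (σ z · z) · z⁻¹ = 1`) — every unimodular
  hermitian lattice of rank `3` at an inert place is isometric to the standard lattice `𝒪³` with the Gram matrix
  `antidiag(1, 1, 1)`; the integrality of `z⁻¹ = σ z · u₀⁻¹` from `σ(𝒪_{E_v}) = 𝒪_{E_v}` (p8's T5-125).
Helpers (abstract `R`, `E`): `isInteger_mul_apply`, `isInteger_diagonal_apply`, `isRUnit_mul`, `isRUnit_inv`,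
`det_diagonal_three`.

Mathlib + seat p8's T5-141 / T5-143 / T5-147 / T5-155 and their imports (p4's completion infrastructure); no display;
no device. §8(d): uses an L-value-free non-vanishing device: NO.
-/

namespace Summit.Ventures.HodgeRepro2.T5InertSelfDualNormalForm

open Matrix IsDedekindDomain IsDedekindDomain.HeightOneSpectrum NumberField Module
open Summit.Ventures.HodgeRepro2.T5IntegralUnits Summit.Ventures.HodgeRepro2.T5HermitianThreeElements
  Summit.Ventures.HodgeRepro2.T5UnitaryGroupIsometry Summit.Ventures.HodgeRepro2.T5StarOfInvolution
  Summit.Ventures.HodgeRepro2.T5InertLatticeNormalForm Summit.Ventures.HodgeRepro2.T5InertPlaceCompletionIsotropy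
  Summit.Ventures.HodgeRepro2.T5InertPlaceCompletion Summit.Ventures.HodgeRepro2.T5SelfDualLatticeDet
  Summit.Ventures.HodgeRepro2.T5UnitaryThreeCorner

/-! ## Integral matrices and `R`-units: closure under products and inverses -/

section General

variable {R E : Type*} [CommRing R] [Field E] [Algebra R E]

/-- The entries of a product of two integral matrices are integral. -/
theorem isInteger_mul_apply {ι : Type*} [Fintype ι] {M N : Matrix ι ι E}
    (hM : ∀ i j, IsLocalization.IsInteger R (M i j)) (hN : ∀ i j, IsLocalization.IsInteger R (N i j)) (i j : ι) :
    IsLocalization.IsInteger R ((M * N) i j) := by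
  rw [Matrix.mul_apply]
  exact isInteger_sum fun k _ => IsLocalization.isInteger_mul (hM i k) (hN k j)

/-- The entries of a diagonal matrix with integral diagonal are integral. -/
theorem isInteger_diagonal_apply {ι : Type*} [DecidableEq ι] {d : ι → E}
    (hd : ∀ i, IsLocalization.IsInteger R (d i)) (i j : ι) :
    IsLocalization.IsInteger R (Matrix.diagonal d i j) := by
  rw [Matrix.diagonal_apply]
  split_ifs
  · exact hd i
  · exact IsLocalization.isInteger_zero

/-- A product of two `R`-units (integral, non-zero, with integral inverse) is an `R`-unit. -/
theorem isRUnit_mul {x y : E} (hx : IsRUnit R x) (hy : IsRUnit R y) : IsRUnit R (x * y) :=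
  ⟨IsLocalization.isInteger_mul hx.1 hy.1, mul_ne_zero hx.2.1 hy.2.1,
    by rw [mul_inv]; exact IsLocalization.isInteger_mul hx.2.2 hy.2.2⟩

/-- The inverse of an `R`-unit is an `R`-unit. -/
theorem isRUnit_inv {x : E} (hx : IsRUnit R x) : IsRUnit R x⁻¹ :=
  ⟨hx.2.2, inv_ne_zero hx.2.1, by rw [inv_inv]; exact hx.1⟩

/-- The three entries of `![a, b, c]` are integral when `a`, `b`, `c` are. -/
theorem isInteger_vec_three {a b c : E} (ha : IsLocalization.IsInteger R a)
    (hb : IsLocalization.IsInteger R b) (hc : IsLocalization.IsInteger R c) (i : Fin 3) :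
    IsLocalization.IsInteger R (![a, b, c] i) := by
  fin_cases i
  · exact ha
  · exact hb
  · exact hc

/-- `det (diag(1, d, 1)) = d`. -/
theorem det_diagonal_three (d : E) : (Matrix.diagonal ![(1 : E), d, 1]).det = d := by
  rw [Matrix.det_diagonal, Fin.prod_univ_three]
  simp only [Matrix.cons_val_zero, Matrix.cons_val_one, Matrix.head_cons, Matrix.cons_val_two,
    Matrix.tail_cons, one_mul, mul_one]

end General

/-! ## On the record's local fields at an inert place -/

section Local

variable {K : Type*} [Field K] [NumberField K] (v : HeightOneSpectrum (𝓞 K))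
variable {L : Type*} [Field L] [NumberField L] [Algebra K L]
variable (w : HeightOneSpectrum (𝓞 L)) [w.asIdeal.LiesOver v.asIdeal]

/-- **T5-141′ on the completions, with no isotropy hypothesis.** At an inert place (`[L_w : K_v] = 2`, a
uniformiser `ϖ` of `O_Kv` irreducible in `O_Lw`), for the conjugation `σ ≠ 1` and the star
`starRingOfQuadratic h2 σ hσ`: every `σ`-hermitian `3 × 3` matrix `H` over `L_w` with entries and inverse in
`𝒪_{E_v} := integralClosure O_Kv L_w` and `IsUnit H.det` is integrally congruent to `antidiag(1, u₀, 1)` with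
`u₀ ∈ O_Kvˣ` — p8's T5-141′ on p8's T5-155 isotropic vector. -/
theorem exists_congruent_J3_integral_adicCompletion
    (h2 : finrank (v.adicCompletion K) (w.adicCompletion L) = 2)
    {ϖ : v.adicCompletionIntegers K} (hϖ : Irreducible ϖ)
    (hinert : Irreducible (algebraMap (v.adicCompletionIntegers K) (w.adicCompletionIntegers L) ϖ))
    (σ : w.adicCompletion L ≃ₐ[v.adicCompletion K] w.adicCompletion L) (hσ : σ ≠ 1)
    {H : Matrix (Fin 3) (Fin 3) (w.adicCompletion L)}
    (hH : letI := starRingOfQuadratic h2 σ hσ; H.IsHermitian)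
    (hint : ∀ i j, IsLocalization.IsInteger
      (integralClosure (v.adicCompletionIntegers K) (w.adicCompletion L)) (H i j))
    (hdet : IsUnit H.det)
    (hinv : ∀ i j, IsLocalization.IsInteger
      (integralClosure (v.adicCompletionIntegers K) (w.adicCompletion L)) (H⁻¹ i j)) :
    letI := starRingOfQuadratic h2 σ hσ
    ∃ P : Matrix (Fin 3) (Fin 3) (w.adicCompletion L),
      (∀ i j, IsLocalization.IsInteger
        (integralClosure (v.adicCompletionIntegers K) (w.adicCompletion L)) (P i j)) ∧
      IsRUnit (integralClosure (v.adicCompletionIntegers K) (w.adicCompletion L)) P.det ∧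
      ∃ u₀ : (v.adicCompletionIntegers K)ˣ,
        P.conjTranspose * H * P =
          J3 (algebraMap (v.adicCompletionIntegers K) (w.adicCompletion L) (u₀ : v.adicCompletionIntegers K)) := by
  haveI := isLocalRing_integralClosure_adicCompletion v w
  obtain ⟨x, hx0, hx⟩ := exists_isotropic_adicCompletion v w h2 hϖ hinert σ hσ hH hdet
  exact exists_congruent_J3_integral_of_isotropic_of_unramified' _ _ _ h2 σ hσ
    (map_maximalIdeal_integralClosure_eq_of_irreducible v w hϖ hinert) H hH hint hdet hinv x hx0 hx

/-- **The normal form `antidiag(1, 1, 1)`: every unimodular hermitian lattice of rank `3` at an inert place is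
isometric to the standard one.** Under the hypotheses of `exists_congruent_J3_integral_adicCompletion`, there is
`P` with entries in `𝒪_{E_v}` and an `𝒪_{E_v}`-unit determinant such that `Pᴴ H P = antidiag(1, 1, 1)`: the
unit `u₀` of T5-141′ is a norm `σ z · z` (p8's T5-155), and `diag(1, z⁻¹, 1)` rescales it to `1`. -/
theorem exists_congruent_J3_one_adicCompletion
    (h2 : finrank (v.adicCompletion K) (w.adicCompletion L) = 2)
    {ϖ : v.adicCompletionIntegers K} (hϖ : Irreducible ϖ)
    (hinert : Irreducible (algebraMap (v.adicCompletionIntegers K) (w.adicCompletionIntegers L) ϖ))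
    (σ : w.adicCompletion L ≃ₐ[v.adicCompletion K] w.adicCompletion L) (hσ : σ ≠ 1)
    {H : Matrix (Fin 3) (Fin 3) (w.adicCompletion L)}
    (hH : letI := starRingOfQuadratic h2 σ hσ; H.IsHermitian)
    (hint : ∀ i j, IsLocalization.IsInteger
      (integralClosure (v.adicCompletionIntegers K) (w.adicCompletion L)) (H i j))
    (hdet : IsUnit H.det)
    (hinv : ∀ i j, IsLocalization.IsInteger
      (integralClosure (v.adicCompletionIntegers K) (w.adicCompletion L)) (H⁻¹ i j)) :
    letI := starRingOfQuadratic h2 σ hσ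
    ∃ P : Matrix (Fin 3) (Fin 3) (w.adicCompletion L),
      (∀ i j, IsLocalization.IsInteger
        (integralClosure (v.adicCompletionIntegers K) (w.adicCompletion L)) (P i j)) ∧
      IsRUnit (integralClosure (v.adicCompletionIntegers K) (w.adicCompletion L)) P.det ∧
      P.conjTranspose * H * P = J3 1 := by
  letI := starRingOfQuadratic h2 σ hσ
  obtain ⟨P, hP, hPdet, u₀, hPHP⟩ :=
    exists_congruent_J3_integral_adicCompletion v w h2 hϖ hinert σ hσ hH hint hdet hinv
  obtain ⟨z, hz, hzz⟩ := exists_isInteger_conj_mul_eq_unit_adicCompletion v w h2 hϖ hinert σ hσ u₀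
  -- the star is `σ`
  have hstar : ∀ y : w.adicCompletion L, star y = σ y := fun y => star_eq σ.toRingEquiv _ y
  -- `a := algebraMap u₀` is a non-zero element of `L_w`
  have ha : algebraMap (v.adicCompletionIntegers K) (w.adicCompletion L) (u₀ : v.adicCompletionIntegers K) ≠ 0 :=
    ((algebraMap (v.adicCompletionIntegers K) (w.adicCompletion L)).isUnit_map u₀.isUnit).ne_zero
  have hz0 : z ≠ 0 := by
    rintro rfl
    exact ha (by rw [← hzz, mul_zero])
  have hσz0 : σ z ≠ 0 := by
    rintro h
    exact ha (by rw [← hzz, h, zero_mul])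
  -- `σ z` is integral (p8's T5-125: `σ` preserves `𝒪_{E_v}`)
  have hσz : IsLocalization.IsInteger
      (integralClosure (v.adicCompletionIntegers K) (w.adicCompletion L)) (σ z) :=
    (isInteger_integralClosure_iff _).2 (map_mem_integralClosure σ ((isInteger_integralClosure_iff _).1 hz))
  -- `a⁻¹` is integral
  have hainv : IsLocalization.IsInteger (integralClosure (v.adicCompletionIntegers K) (w.adicCompletion L))
      (algebraMap (v.adicCompletionIntegers K) (w.adicCompletion L) (u₀ : v.adicCompletionIntegers K))⁻¹ := by
    rw [IsScalarTower.algebraMap_apply (v.adicCompletionIntegers K)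
      (integralClosure (v.adicCompletionIntegers K) (w.adicCompletion L)) (w.adicCompletion L)]
    exact isInteger_inv_of_isUnit ((algebraMap (v.adicCompletionIntegers K)
      (integralClosure (v.adicCompletionIntegers K) (w.adicCompletion L))).isUnit_map u₀.isUnit)
  -- `z⁻¹ = σ z · a⁻¹` is integral
  have hzinv_eq : z⁻¹ = σ z *
      (algebraMap (v.adicCompletionIntegers K) (w.adicCompletion L) (u₀ : v.adicCompletionIntegers K))⁻¹ := by
    rw [← hzz, mul_inv, ← mul_assoc, mul_inv_cancel₀ hσz0, one_mul]
  have hzinv : IsLocalization.IsInteger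
      (integralClosure (v.adicCompletionIntegers K) (w.adicCompletion L)) z⁻¹ := by
    rw [hzinv_eq]
    exact IsLocalization.isInteger_mul hσz hainv
  have hzunit : IsRUnit (integralClosure (v.adicCompletionIntegers K) (w.adicCompletion L)) z⁻¹ :=
    ⟨hzinv, inv_ne_zero hz0, by rw [inv_inv]; exact hz⟩
  -- the rescaling matrix
  set D : Matrix (Fin 3) (Fin 3) (w.adicCompletion L) := Matrix.diagonal ![1, z⁻¹, 1] with hD
  have hDint : ∀ i j, IsLocalization.IsInteger
      (integralClosure (v.adicCompletionIntegers K) (w.adicCompletion L)) (D i j) :=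
    isInteger_diagonal_apply (isInteger_vec_three IsLocalization.isInteger_one hzinv IsLocalization.isInteger_one)
  refine ⟨P * D, isInteger_mul_apply hP hDint, ?_, ?_⟩
  · rw [Matrix.det_mul, hD, det_diagonal_three]
    exact isRUnit_mul hPdet hzunit
  · have key : (P * D).conjTranspose * H * (P * D) = D.conjTranspose * (P.conjTranspose * H * P) * D := by
      simp only [Matrix.conjTranspose_mul, Matrix.mul_assoc]
    rw [key, hPHP, hD, conjTranspose_diagonal_mul_J3_mul_diagonal, hstar, map_inv₀, ← hzz]
    congr 1
    field_simp

end Local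

end Summit.Ventures.HodgeRepro2.T5InertSelfDualNormalForm
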